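import Summits.QuantumFields.YangMills.Theorems.BalabanUVNodesN11AFibreDominationOnJointSupport
import Literature.MathematicalPhysics.QuantumFieldTheory.Balaban1983to89.Node00.Record12LocalLawsTwoScale

/-!
# DAG node N11 — THE JOINT-SUPPORT MACHINERY UNDER PRINT'S TWO-SCALE LOCALITY OF THE RESIDUAL FACTOR `ζ_j` (scales `j` AND `j+1`):
# n11-w4's congruence ∕ integrability theorems on the JOINT SUPPORT (p598996) and their generic-`θ` corollaries, with 12b's one-scale row
# `ω j = ω′ j → ζ0 j Y ω = ζ0 j Y ω′` WEAKENED to node00's `TkResidualW.LocalLaws₂` (p692453; FLAG №1 N11 cure text (b′), plan g91 custodian word 2026-08-29T03:14Z)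

HEADER — WORK-UNIT METADATA.  Cell `pub-ymgap`, YM-PLAN Track A (HUMAN RULING D-0062), seat `pub-ymgap-dag-n11-d` (g31) on NODE n11 [B14]; route `BalabanUVNodes`,
item K1⁹ `StabilityBRunRowsAtRecordR13SepCoPHV` = stmt-QuantumFields-27364 (helper, `--kind proof --supports 27364 --as helper`, count-neutral).  Sibling of this
seat's `…N11TwoScaleLocalityReadingLocus` (p692578: the READING-LOCUS editions); this file does the same for n11-w4 g2's `…N11AFibreDominationOnJointSupport`
§1 ∕ §2 ∕ §4 (proofs VERBATIM but for ONE extra agreement line in §1).  [III] = [Balaban1988Convergent].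

WHY THIS FILE (located, count-neutral).  [III] p.264 bottom ∕ (3.2) p.265 ∕ p.267: `ζ(Ω^c_{k+1})` READS THE NEW FIELD `V_{k+1}` (`(ω (k+1)).1` in 11a's indexing);
12b's one-scale row (`Record12` `TkResidualW.LocalLaws.zeta0_local` = field `zhLocal` of `Provisos₁₃CoPH` ∕ `Provisos₁₃SepCoPH`) is STRONGER than print, and the
plan's word makes node00's two-scale `LocalLaws₂` the cure text; K1⁹'s re-pin (`zhLocal` over `LocalLaws₂`, v11) rides the next press.  The proviso-row reader
`…N11NoExpansionStepSpecificationOfCoerciveOnJointSupport` (:152) consumes §3 below through `h.zhLocal`; this file puts its `LocalLaws₂`-keyed callee in the tree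
so the v11 chain elaborates on landing.  Inside `𝐓_k` generation `m` modifies component `m` only, and `ζ_i` (`i > m`) is compared at configurations differing at
component `m < i` — so components `i` and `i+1` agree and the two-scale law suffices.

WHAT THIS FILE PROVES (0 `sorry`, 0 `def`; standard axioms).
§1 ★★ `tkBranchOfRecord_congr_on_joint_support₂` — p598996 §1 under the two-scale `hζloc` (coarse form).
§2 ★★ `integrable_front_mul_tkBranchOfRecord_baseCfg_of_dominated_on_joint_support₂` — p598996 §2 over §1.
§3 ★★★ `integrable_front_mul_oldBranch_of_coercive_on_joint_support₂` ∕ `…_on_joint_regular₂` — p598996 §4 at generic `θ : Stage13HParams` with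
   `(hloc₂ : (θ.zhAt p s′).LocalLaws₂)` displayed IN PLACE OF the core proviso `zhLocal` (which implies it: `TkResidualW.LocalLaws.localLaws₂`).

HONEST FRAMING.  Helper lane of K1⁹; generalizations (weaker hypothesis) of accepted tree theorems, proofs verbatim modulo one line; no law of record is edited or
posited; nothing re-keyed (K1⁹ v10 untouched).  Nothing of Bałaban asserted or refuted; K1⁹ `∃θ` NOT refuted; N11 NOT discharged; counts unmoved (typed 28∕28 ·
discharged 8∕27).  One finite four-torus programme at fixed `ε = L^{−K}`; NOT ℝ⁴, NOT OS, NOT a mass gap, NOT Clay.  No `sorry`, `axiom`, `def`, `instance`, `notation`.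
Sources (SHAPE only): [III] (2.10) p.256, (2.18) p.257, (2.20)–(2.23) p.258, (3.2)–(3.3) p.265, p.267, (3.16)–(3.21) pp.268–269, (3.23)–(3.24) p.270; [Balaban1987RG1] (2.11) p.267.
-/

noncomputable section

open MeasureTheory
open scoped BigOperators ENNReal NNReal Matrix.Norms.L2Operator

namespace Summit.QuantumFields.YangMills.Theorems.BalabanUVNodesN11TwoScaleLocalityJointSupport

open Literature.MathematicalPhysics.QuantumFieldTheory.Balaban1983to89 T4Continuum T4NestedCovariance T4AdjointCovariance Node00 Node00.Tk
open B15DeterminingSets (MSField)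
open B10Eq42TorusConstraint (bondsIn)
open BalabanUVNodesN11TkBranchMassBound (integrable_tkBranchOfRecord_baseCfg_of_dominated)
open BalabanUVNodesN11AFibreDominationOfCoercive (measurable_gaussMajorant lintegral_gaussMajorant_ne_top exp_neg_half_le_gaussMajorant)
open BalabanUVNodesN11AFibreDominationOnSupport (aOp_congr_of_eq_on_fibre)
open BalabanUVNodesN11OldBranchIntegrableOfDominated (zhAt_ζ0_le_one_of_unity)
open BalabanUVNodesN11DiagonalOldBranchMeasurable (measurable_WtOfRecord₁₃H_ζ measurable_WtOfRecord₁₃H_w)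
open BalabanUVNodesN11NoExpansionDiagonalCoPH (WtOfRecord₁₃H_eq_tkWeightsOfRecordP)
open BalabanUVNodesN11NoExpansionDiagonalAtZ (tkWeightsOfRecordP_ζ_apply tkWeightsOfRecordP_ζ_local)
open BalabanUVNodesN11AFibreDominationOnJointSupport

section S1

variable {F : T4Family} {N : ℕ} [NeZero N] {V : Type} [NormedAddCommGroup V] [InnerProductSpace ℝ V] [FiniteDimensional ℝ V]
  [MeasurableSpace V] [BorelSpace V]
variable (ν : Stage7Numerics) (M : ℕ) (g : ℕ → ℝ) (K : ℕ)

/-- **★★ (TWO-SCALE EDITION of p598996 §1) CONGRUENCE OF THE BRANCH OPERATORS ON THE JOINT SUPPORT.**  Two weight data `W, W′` with the same `ζ_j((Ω_{j+1})ᶜ)` below `k`, each `ζ_i` reading the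
scale-`i` configuration only (`i < k`), and A-weights agreeing — `w′_j(Λ_{j+1}, Λᶜ_{j+1}∩Ω_{j+1}, S_{j+1}) = w_j(…)` at `ω′` — whenever `ω′` satisfies an ambient predicate
`Amb` (stable under changes of the components `< k`) and the JOINT SUPPORT condition «for every `i` with `j ≤ i < k` there is a scale-`i` configuration `c` agreeing with
`ω′ i` in the gauge part and in the fluctuation part off the A-bonds `bondsIn i (Λᶜ_{i+1}∩Ω_{i+1})`, with `ζ_i((Ω_{i+1})ᶜ)(ω′[i := c]) ≠ 0`», give the SAME value
`𝐓_k(s,S)[W′] Φ ω = 𝐓_k(s,S)[W] Φ ω` at every `Amb` configuration `ω`.  (Induction over the generations `m ≤ k` on values: generation `m` modifies component `m`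
only, so the outer certificates `i > m` stay alive inside, and `ζ_m(ω_y) ≠ 0` makes `ω_y` the `A_m`-fibre-mate for the inner call.)
[cite: Balaban1988Convergent, (2.20)–(2.21) p.258, (3.24) p.270, (2.10) p.256] -/
theorem tkBranchOfRecord_congr_on_joint_support₂ (W W' : TkWeights F N V K) {n : ℕ} (s : SeqOfRecord F ν M g K n) (S : ℕ → Set (Site (F.P K) 0))
    (k : ℕ) (Amb : MultiCfg (F.P K) (SU N) V → Prop)
    (hAmb : ∀ ω ω' : MultiCfg (F.P K) (SU N) V, (∀ i, k ≤ i → ω' i = ω i) → Amb ω → Amb ω')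
    (hζ : ∀ j, j < k → W'.ζ j (s.Ω (j + 1))ᶜ = W.ζ j (s.Ω (j + 1))ᶜ)
    (hζloc : ∀ j, j < k → ∀ ω ω' : MultiCfg (F.P K) (SU N) V, ω j = ω' j → ω (j + 1) = ω' (j + 1) →
      W.ζ j (s.Ω (j + 1))ᶜ ω = W.ζ j (s.Ω (j + 1))ᶜ ω')
    (hw : ∀ j, j < k → ∀ ω' : MultiCfg (F.P K) (SU N) V, Amb ω' →
      (∀ i, j ≤ i → i < k → ∃ c : JCfg (F.P K) i (SU N) V, c.1 = (ω' i).1 ∧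
        (∀ b, b ∉ bondsIn i ((s.Λ (i + 1))ᶜ ∩ s.Ω (i + 1)) → c.2 b = (ω' i).2 b) ∧ W.ζ i (s.Ω (i + 1))ᶜ (Function.update ω' i c) ≠ 0) →
      W'.w j (s.Λ (j + 1)) ((s.Λ (j + 1))ᶜ ∩ s.Ω (j + 1)) (S (j + 1)) ω' = W.w j (s.Λ (j + 1)) ((s.Λ (j + 1))ᶜ ∩ s.Ω (j + 1)) (S (j + 1)) ω')
    (Φ : MultiCfg (F.P K) (SU N) V → ℝ) (ω : MultiCfg (F.P K) (SU N) V) (hω : Amb ω) :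
    tkBranchOfRecord F N V ν M g K W' s S k Φ ω = tkBranchOfRecord F N V ν M g K W s S k Φ ω := by
  -- the induction over the generations, on VALUES, carrying the ambient predicate and the certificates of the generations `≥ m`
  have key : ∀ m, m ≤ k → ∀ ω : MultiCfg (F.P K) (SU N) V, Amb ω →
      (∀ i, m ≤ i → i < k → ∃ c : JCfg (F.P K) i (SU N) V, c.1 = (ω i).1 ∧
        (∀ b, b ∉ bondsIn i ((s.Λ (i + 1))ᶜ ∩ s.Ω (i + 1)) → c.2 b = (ω i).2 b) ∧ W.ζ i (s.Ω (i + 1))ᶜ (Function.update ω i c) ≠ 0) →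
      tkBranchOfRecord F N V ν M g K W' s S m Φ ω = tkBranchOfRecord F N V ν M g K W s S m Φ ω := by
    intro m
    induction m with
    | zero => intro _ ω _ _; rfl
    | succ m ih =>
        intro hm ω hAω hsupp
        have hmk : m < k := Nat.lt_of_succ_le hm
        -- 11a's generations carry the CLASSICAL `DecidableEq` on bonds
        letI hdec : DecidableEq (PBond (F.P K) m) := fun a b => Classical.propDecidable (a = b)
        rw [tkBranchOfRecord_succ, tkBranchOfRecord_succ]
        simp only [genOp_apply, vOp_apply, zetaOp_apply]
        show kernelRTOfRecord F N K m _ _ _ _ = kernelRTOfRecord F N K m _ _ _ _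
        congr 1
        funext y
        -- the configuration after the V-update of generation `m`
        set ωy : MultiCfg (F.P K) (SU N) V := Function.update ω m
          (Function.updateFinset (ω m).1 (Set.toFinite (bondsIn m (s.Ω (m + 1))ᶜ)).toFinset y, (ω m).2) with hωy
        have hωy_ne : ∀ i, i ≠ m → ωy i = ω i := fun i hi => by rw [hωy, Function.update_of_ne hi]
        show W'.ζ m (s.Ω (m + 1))ᶜ ωy * _ = W.ζ m (s.Ω (m + 1))ᶜ ωy * _
        rw [hζ m hmk]
        by_cases hζ0 : W.ζ m (s.Ω (m + 1))ᶜ ωy = 0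
        · rw [hζ0, zero_mul, zero_mul]
        · congr 1
          rw [aOp_apply, aOp_apply]
          refine congrArg (fun φ : (↥(Set.toFinite (bondsIn m ((s.Λ (m + 1))ᶜ ∩ s.Ω (m + 1)))).toFinset → V) → ℝ =>
            ∫ a, φ a ∂(Measure.pi fun _ => (volume : Measure V))) (funext fun a => ?_)
          -- the configuration after the A-update: on the `A_m`-fibre of `ωy`, components `≠ m` untouched
          set ωa : MultiCfg (F.P K) (SU N) V := Function.update ωy m
            (insA (Set.toFinite (bondsIn m ((s.Λ (m + 1))ᶜ ∩ s.Ω (m + 1)))).toFinset a (ωy m)) with hωa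
          have hωa_ne : ∀ i, i ≠ m → ωa i = ω i := fun i hi => by rw [hωa, Function.update_of_ne hi, hωy_ne i hi]
          have hωa_m1 : (ωa m).1 = (ωy m).1 := by rw [hωa, Function.update_self]; rfl
          have hωa_m2 : ∀ b, b ∉ bondsIn m ((s.Λ (m + 1))ᶜ ∩ s.Ω (m + 1)) → (ωy m).2 b = (ωa m).2 b := fun b hb => by
            have h' : (ωa m).2 b = (ωy m).2 b := by
              rw [hωa, Function.update_self]
              show Function.updateFinset (ωy m).2 _ a b = (ωy m).2 b
              rw [Function.updateFinset_def]
              exact dif_neg fun h => hb ((Set.Finite.mem_toFinset _).mp h)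
            exact h'.symm
          have hωa_back : Function.update ωa m (ωy m) = ωy := by
            rw [hωa, Function.update_idem, Function.update_eq_self]
          have hAa : Amb ωa := hAmb ω ωa (fun i hi => hωa_ne i (Nat.ne_of_lt (lt_of_lt_of_le hmk hi)).symm) hAω
          -- the joint support at `ωa` for every `i ∈ [m, k)`
          have hsuppa : ∀ i, m ≤ i → i < k → ∃ c : JCfg (F.P K) i (SU N) V, c.1 = (ωa i).1 ∧
              (∀ b, b ∉ bondsIn i ((s.Λ (i + 1))ᶜ ∩ s.Ω (i + 1)) → c.2 b = (ωa i).2 b) ∧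
              W.ζ i (s.Ω (i + 1))ᶜ (Function.update ωa i c) ≠ 0 := by
            intro i hmi hik
            by_cases him : i = m
            · subst him
              refine ⟨ωy i, hωa_m1.symm, hωa_m2, ?_⟩
              rw [hωa_back]
              exact hζ0
            · obtain ⟨c, hc1, hc2, hcζ⟩ := hsupp i (by omega) hik
              refine ⟨c, by rw [hωa_ne i him]; exact hc1, fun b hb => by rw [hωa_ne i him]; exact hc2 b hb, ?_⟩
              rw [hζloc i hik (Function.update ωa i c) (Function.update ω i c) (by rw [Function.update_self, Function.update_self])
                (by rw [Function.update_of_ne (Nat.succ_ne_self i), Function.update_of_ne (Nat.succ_ne_self i), hωa_ne (i + 1) (by omega)])]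
              exact hcζ
          show W'.w m (s.Λ (m + 1)) ((s.Λ (m + 1))ᶜ ∩ s.Ω (m + 1)) (S (m + 1)) ωa * tkBranchOfRecord F N V ν M g K W' s S m Φ ωa =
            W.w m (s.Λ (m + 1)) ((s.Λ (m + 1))ᶜ ∩ s.Ω (m + 1)) (S (m + 1)) ωa * tkBranchOfRecord F N V ν M g K W s S m Φ ωa
          rw [hw m hmk ωa hAa hsuppa, ih hmk.le ωa hAa hsuppa]
  exact key k le_rfl ω hω (fun i hi hik => absurd hik (not_lt.mpr hi))

end S1

section S2

variable {F : T4Family} {N : ℕ} [NeZero N] {V : Type} [NormedAddCommGroup V] [InnerProductSpace ℝ V] [FiniteDimensional ℝ V]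
  [MeasurableSpace V] [BorelSpace V]
variable (ν : Stage7Numerics) (M : ℕ) (g : ℕ → ℝ) (K : ℕ)
variable (W : TkWeights F N V K)

/-- **★★ (TWO-SCALE EDITION of p598996 §2) `U₀ ↦ f(U₀)·𝐓_k(s,S)[Φ](base_k U₀)` IS INTEGRABLE UNDER A-FIBRE DOMINATION ON THE JOINT SUPPORT** — dag-n11-d's C2 §5 with a bounded measurable FRONT
FACTOR `f` (the step's own weight `χ_k·w_k`, read at the level-`k` gauge component) and its domination row WEAKENED to: for `j < k`, at every configuration `ω′` with
`f((ω′ k).1) ≠ 0` AND the joint support condition «∀ i ∈ [j,k), ∃ c agreeing with `ω′ i` in the gauge part and off the `A_i`-bonds, `ζ_i((Ω_{i+1})ᶜ)(ω′[i := c]) ≠ 0`»,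
`ofReal (w_j ω′) ≤ ŵ_j(A_j ω′|_{sA_j})`.  Requires the locality of `ζ_i` (`i < k`).  PROOF: guarded weights `χ_A′ := 𝟙[row]·χ_A` (dominated everywhere ⇒ C2 §5 ⇒
`f·𝐓_k[W′]` integrable by `Integrable.mul_bdd`), and `f(U₀)·𝐓_k[W′](base U₀) = f(U₀)·𝐓_k[W](base U₀)` by §1 with the ambient predicate `f((ω k).1) ≠ 0` (the generations
`< k` never touch component `k`, which is `U₀` at the base configuration). [cite: Balaban1988Convergent, (2.18) p.257, (2.20)–(2.21) p.258, (3.23)–(3.24) p.270, (2.10) p.256] -/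
theorem integrable_front_mul_tkBranchOfRecord_baseCfg_of_dominated_on_joint_support₂ {n : ℕ} (s : SeqOfRecord F ν M g K n)
    (S : ℕ → Set (Site (F.P K) 0)) (k : ℕ)
    (hζm : ∀ j, Measurable (W.ζ j (s.Ω (j + 1))ᶜ)) (hζ0 : ∀ j ω, 0 ≤ W.ζ j (s.Ω (j + 1))ᶜ ω) (hζ1 : ∀ j ω, W.ζ j (s.Ω (j + 1))ᶜ ω ≤ 1)
    (hζloc : ∀ j, j < k → ∀ ω ω' : MultiCfg (F.P K) (SU N) V, ω j = ω' j → ω (j + 1) = ω' (j + 1) →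
      W.ζ j (s.Ω (j + 1))ᶜ ω = W.ζ j (s.Ω (j + 1))ᶜ ω')
    (hwm : ∀ j, Measurable (W.w j (s.Λ (j + 1)) ((s.Λ (j + 1))ᶜ ∩ s.Ω (j + 1)) (S (j + 1))))
    (hw0 : ∀ j ω, 0 ≤ W.w j (s.Λ (j + 1)) ((s.Λ (j + 1))ᶜ ∩ s.Ω (j + 1)) (S (j + 1)) ω)
    (ŵ : (j : ℕ) → (↥(Set.toFinite (bondsIn j ((s.Λ (j + 1))ᶜ ∩ s.Ω (j + 1)))).toFinset → V) → ℝ≥0∞) (hŵm : ∀ j, Measurable (ŵ j))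
    (f : GaugeField (F.P K) k (SU N) → ℝ) (hfm : Measurable f) (Cf : ℝ) (hfb : ∀ U, |f U| ≤ Cf)
    (hdom : ∀ j, j < k → ∀ ω' : MultiCfg (F.P K) (SU N) V, f (ω' k).1 ≠ 0 →
      (∀ i, j ≤ i → i < k → ∃ c : JCfg (F.P K) i (SU N) V, c.1 = (ω' i).1 ∧
        (∀ b, b ∉ bondsIn i ((s.Λ (i + 1))ᶜ ∩ s.Ω (i + 1)) → c.2 b = (ω' i).2 b) ∧ W.ζ i (s.Ω (i + 1))ᶜ (Function.update ω' i c) ≠ 0) →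
      ENNReal.ofReal (W.w j (s.Λ (j + 1)) ((s.Λ (j + 1))ᶜ ∩ s.Ω (j + 1)) (S (j + 1)) ω') ≤
        ŵ j (fun b : ↥(Set.toFinite (bondsIn j ((s.Λ (j + 1))ᶜ ∩ s.Ω (j + 1)))).toFinset => (ω' j).2 b))
    (Cw : ℕ → ℝ≥0) (hCw : ∀ j, ∫⁻ a, ŵ j a ∂(Measure.pi fun _ : ↥(Set.toFinite (bondsIn j ((s.Λ (j + 1))ᶜ ∩ s.Ω (j + 1)))).toFinset => (volume : Measure V)) ≤ Cw j)
    {Φ : MultiCfg (F.P K) (SU N) V → ℝ} (hΦm : Measurable Φ) (hΦ0 : ∀ ω, 0 ≤ Φ ω) (CΦ : ℝ) (hΦle : ∀ ω, Φ ω ≤ CΦ) :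
    Integrable (fun U₀ : GaugeField (F.P K) k (SU N) => f U₀ * tkBranchOfRecord F N V ν M g K W s S k Φ (baseCfg k U₀))
      (fieldMeasure (F.P K) k (SU N)) := by
  -- the guard sets and the guarded weights (as in `…N11AFibreDominationOnSupport` §2)
  let Gd : ℕ → Set (MultiCfg (F.P K) (SU N) V) := fun j =>
    {ω | ENNReal.ofReal (W.w j (s.Λ (j + 1)) ((s.Λ (j + 1))ᶜ ∩ s.Ω (j + 1)) (S (j + 1)) ω) ≤
      ŵ j (fun b : ↥(Set.toFinite (bondsIn j ((s.Λ (j + 1))ᶜ ∩ s.Ω (j + 1)))).toFinset => (ω j).2 b)}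
  have hproj : ∀ j, Measurable (fun ω : MultiCfg (F.P K) (SU N) V =>
      (fun b : ↥(Set.toFinite (bondsIn j ((s.Λ (j + 1))ᶜ ∩ s.Ω (j + 1)))).toFinset => (ω j).2 b)) := fun j =>
    measurable_pi_lambda _ fun b => (measurable_pi_apply (b : PBond (F.P K) j)).comp (measurable_snd.comp (measurable_pi_apply j))
  have hGd : ∀ j, MeasurableSet (Gd j) := fun j => measurableSet_le (hwm j).ennreal_ofReal ((hŵm j).comp (hproj j))
  let W' : TkWeights F N V K := ⟨W.ζ, W.quad, fun j Y S' => (Gd j).indicator (W.chiA j Y S')⟩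
  have hw' : ∀ (j : ℕ) (Λ' Y S' : Set (Site (F.P K) 0)), W'.w j Λ' Y S' = (Gd j).indicator (W.w j Λ' Y S') := by
    intro j Λ' Y S'
    funext ω
    show (Gd j).indicator (W.chiA j Y S') ω * Real.exp (-(1 / 2 : ℝ) * W.quad j Λ' ω) =
      (Gd j).indicator (fun ω => W.chiA j Y S' ω * Real.exp (-(1 / 2 : ℝ) * W.quad j Λ' ω)) ω
    exact (Set.indicator_mul_left (Gd j) (W.chiA j Y S') (fun ω => Real.exp (-(1 / 2 : ℝ) * W.quad j Λ' ω))).symm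
  have hwm' : ∀ j, Measurable (W'.w j (s.Λ (j + 1)) ((s.Λ (j + 1))ᶜ ∩ s.Ω (j + 1)) (S (j + 1))) := fun j => by
    rw [hw']
    exact (hwm j).indicator (hGd j)
  have hw0' : ∀ j ω, 0 ≤ W'.w j (s.Λ (j + 1)) ((s.Λ (j + 1))ᶜ ∩ s.Ω (j + 1)) (S (j + 1)) ω := fun j ω => by
    rw [hw']
    exact Set.indicator_nonneg (fun ω _ => hw0 j ω) ω
  have hdom' : ∀ j ω, ENNReal.ofReal (W'.w j (s.Λ (j + 1)) ((s.Λ (j + 1))ᶜ ∩ s.Ω (j + 1)) (S (j + 1)) ω) ≤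
      ŵ j (fun b : ↥(Set.toFinite (bondsIn j ((s.Λ (j + 1))ᶜ ∩ s.Ω (j + 1)))).toFinset => (ω j).2 b) := fun j ω => by
    rw [hw']
    by_cases hω : ω ∈ Gd j
    · rw [Set.indicator_of_mem hω]
      exact hω
    · rw [Set.indicator_of_notMem hω, ENNReal.ofReal_zero]
      exact bot_le
  -- C2 §5 at the guarded weights, times the bounded front factor
  have hB : Integrable (fun U₀ : GaugeField (F.P K) k (SU N) => tkBranchOfRecord F N V ν M g K W' s S k Φ (baseCfg k U₀))
      (fieldMeasure (F.P K) k (SU N)) :=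
    integrable_tkBranchOfRecord_baseCfg_of_dominated ν M g K W' s S hζm hζ0 hζ1 hwm' hw0' ŵ hŵm hdom' Cw hCw hΦm hΦ0 CΦ hΦle k
  have hBf : Integrable (fun U₀ : GaugeField (F.P K) k (SU N) => tkBranchOfRecord F N V ν M g K W' s S k Φ (baseCfg k U₀) * f U₀)
      (fieldMeasure (F.P K) k (SU N)) :=
    hB.mul_bdd hfm.aestronglyMeasurable (c := Cf) (Filter.Eventually.of_forall fun U₀ => by rw [Real.norm_eq_abs]; exact hfb U₀)
  -- on `f ≠ 0` the two branch operators agree at the base configuration (§1 with the ambient predicate `f((ω k).1) ≠ 0`)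
  have heq : (fun U₀ : GaugeField (F.P K) k (SU N) => f U₀ * tkBranchOfRecord F N V ν M g K W s S k Φ (baseCfg k U₀)) =
      fun U₀ => tkBranchOfRecord F N V ν M g K W' s S k Φ (baseCfg k U₀) * f U₀ := by
    funext U₀
    by_cases hf0 : f U₀ = 0
    · rw [hf0, zero_mul, mul_zero]
    · rw [mul_comm]
      congr 1
      refine (tkBranchOfRecord_congr_on_joint_support₂ ν M g K W W' s S k (fun ω => f (ω k).1 ≠ 0) (fun ω ω' hag hω => ?_)
        (fun j _ => rfl) hζloc (fun j hj ω' hAω hsupp => ?_) Φ (baseCfg k U₀) ?_).symm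
      · rw [hag k le_rfl]; exact hω
      · rw [hw']
        refine Set.indicator_of_mem ?_ _
        exact hdom j hj ω' hAω hsupp
      · show f ((baseCfg (V := V) k U₀) k).1 ≠ 0
        rw [show ((baseCfg (V := V) k U₀) k).1 = U₀ from funext fun b => baseCfg_fst_self (V := V) k U₀ b]
        exact hf0
  rw [heq]
  exact hBf

end S2

section S3

variable {F : T4Family} {N : ℕ} [NeZero N]
variable (θ : Stage13HParams F N) (p : B12.RunParams)

/-- **★★★ (TWO-SCALE EDITION of p598996 §4) `U₀ ↦ f(U₀)·𝐓_k(init s′, S)[Φ](base_k U₀)` IS INTEGRABLE FROM COERCIVITY OF THE RESIDUAL's `quad` ON THE JOINT SUPPORT**, generic `θ : Stage13HParams`,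
any history `s′` of length `k+1`, any branch `S`, any operand `Φ` of r11's shape, any bounded measurable front factor `f`: (i) residual rows — `zhLaws`, `ZhUnity`,
LOCALITY in node00's TWO-SCALE form `LocalLaws₂` of the residual serving `s′`
(displayed; implied by the core proviso `zhLocal`), measurability of `ζ0_j(Y)`∕`quad_j(Λ′)`; (ii⁗) per generation `j < k` a `c_j > 0` with
`c_j·Σ_{b∈sA_j} ‖A_j(b)‖² ≤ quad_j(Λ_{j+1}(init s′))(ω′)` at every `ω′` where the FRONT FACTOR IS ALIVE (`f((ω′ k).1) ≠ 0`) AND, for EVERY `i ∈ [j,k)`, some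
`A_i`-fibre-mate of `ω′` (same gauge part, same fluctuation variables off the `A_i`-bonds) has `ζ0_i((Ω_{i+1}(init s′))ᶜ) ≠ 0` ([I]'s positivity of `𝒬_j` where EVERY
certificate of the integrand is alive; displayed); (iii) `Φ` measurable, `0 ≤ Φ ≤ CΦ`.
[cite: Balaban1988Convergent, (2.18) p.257, (2.20)–(2.23) p.258, (2.10) p.256, (3.16)–(3.21) pp.268–269, (3.23)–(3.24) p.270; Balaban1987RG1, (2.11) p.267 (shape of the row)] -/
theorem integrable_front_mul_oldBranch_of_coercive_on_joint_support₂
    (hZ : ∀ (p : B12.RunParams) (n : ℕ) (Ω Λ : ℕ → Set (Site (F.P p.K) 0)), (θ.Zh p n Ω Λ).Laws) (hU : θ.ZhUnity F N) {k : ℕ}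
    (s : SeqOfRecord F θ.ν θ.τ9.M (gOfRecord₁₃ F N θ.toStage13Params p) p.K (k + 1)) (hloc : (θ.zhAt p s).LocalLaws₂)
    (S : ℕ → Set (Site (F.P p.K) 0))
    (hζm : ∀ j (Y : Set (Site (F.P p.K) 0)), Measurable ((θ.zhAt p s).ζ0 j Y))
    (hqm : ∀ j (Λ' : Set (Site (F.P p.K) 0)), Measurable ((θ.zhAt p s).quad j Λ'))
    (f : GaugeField (F.P p.K) k (SU N) → ℝ) (hfm : Measurable f) (Cf : ℝ) (hfb : ∀ U, |f U| ≤ Cf)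
    (hcoer : ∀ j : ℕ, j < k → ∃ c : ℝ, 0 < c ∧ ∀ ω' : MultiCfg (F.P p.K) (SU N) (FluctV N), f (ω' k).1 ≠ 0 →
      (∀ i, j ≤ i → i < k → ∃ cf : JCfg (F.P p.K) i (SU N) (FluctV N), cf.1 = (ω' i).1 ∧
        (∀ b, b ∉ bondsIn i ((s.init.Λ (i + 1))ᶜ ∩ s.init.Ω (i + 1)) → cf.2 b = (ω' i).2 b) ∧
        (θ.zhAt p s).ζ0 i (s.init.Ω (i + 1))ᶜ (Function.update ω' i cf) ≠ 0) →
      c * ∑ b ∈ (Set.toFinite (bondsIn j ((s.init.Λ (j + 1))ᶜ ∩ s.init.Ω (j + 1)))).toFinset, ‖(ω' j).2 b‖ ^ 2 ≤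
        (θ.zhAt p s).quad j (s.init.Λ (j + 1)) ω')
    {Φ : SFluct (F.P p.K) (FluctV N) → MSField (F.P p.K) (SU N) → ℝ}
    (hΦm : Measurable fun ω : MultiCfg (F.P p.K) (SU N) (FluctV N) => Φ (S, fun j => (ω j).2) (fun j => (ω j).1))
    (hΦ0 : ∀ a U, 0 ≤ Φ a U) (CΦ : ℝ) (hΦle : ∀ a U, Φ a U ≤ CΦ) :
    Integrable (fun U₀ : GaugeField (F.P p.K) k (SU N) => f U₀ *
      tkBranchOfRecord F N (FluctV N) θ.ν θ.τ9.M _ p.K (WtOfRecord₁₃H F N θ p s) s.init S k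
        (fun ω => Φ (S, fun j => (ω j).2) (fun j => (ω j).1)) (baseCfg (V := FluctV N) k U₀)) (fieldMeasure (F.P p.K) k (SU N)) := by
  have hWlaws : (WtOfRecord₁₃H F N θ p s).Laws := WtOfRecord₁₃H_laws hZ p s
  -- per generation: a Gaussian majorant (with `c := 1` when `j ≥ k`, where the row is not asked)
  have hrow : ∀ j : ℕ, ∃ ŵ : (↥(Set.toFinite (bondsIn j ((s.init.Λ (j + 1))ᶜ ∩ s.init.Ω (j + 1)))).toFinset → FluctV N) → ℝ≥0∞,
      Measurable ŵ ∧
      (∫⁻ a, ŵ a ∂(Measure.pi fun _ : ↥(Set.toFinite (bondsIn j ((s.init.Λ (j + 1))ᶜ ∩ s.init.Ω (j + 1)))).toFinset =>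
        (volume : Measure (FluctV N)))) ≠ ⊤ ∧
      ∀ ω' : MultiCfg (F.P p.K) (SU N) (FluctV N), (j < k ∧ f (ω' k).1 ≠ 0 ∧
        ∀ i, j ≤ i → i < k → ∃ cf : JCfg (F.P p.K) i (SU N) (FluctV N), cf.1 = (ω' i).1 ∧
          (∀ b, b ∉ bondsIn i ((s.init.Λ (i + 1))ᶜ ∩ s.init.Ω (i + 1)) → cf.2 b = (ω' i).2 b) ∧
          (θ.zhAt p s).ζ0 i (s.init.Ω (i + 1))ᶜ (Function.update ω' i cf) ≠ 0) →
        ENNReal.ofReal ((WtOfRecord₁₃H F N θ p s).w j (s.init.Λ (j + 1)) ((s.init.Λ (j + 1))ᶜ ∩ s.init.Ω (j + 1)) (S (j + 1)) ω') ≤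
          ŵ (fun b : ↥(Set.toFinite (bondsIn j ((s.init.Λ (j + 1))ᶜ ∩ s.init.Ω (j + 1)))).toFinset => (ω' j).2 b) := fun j => by
    by_cases hj : j < k
    · obtain ⟨c, hc, h⟩ := hcoer j hj
      exact afibre_dominated_under_of_coercive_under θ.ν θ.A₁ p (gOfRecord₁₃ F N θ.toStage13Params p) (θ.zhAt p s) j _ _ _ _ hc
        fun ω' hpre => h ω' hpre.2.1 hpre.2.2
    · exact afibre_dominated_under_of_coercive_under θ.ν θ.A₁ p (gOfRecord₁₃ F N θ.toStage13Params p) (θ.zhAt p s) j _ _ _ _ one_pos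
        fun ω' hpre => absurd hpre.1 hj
  choose ŵ hŵm hŵfin hdom using hrow
  refine integrable_front_mul_tkBranchOfRecord_baseCfg_of_dominated_on_joint_support₂ θ.ν θ.τ9.M (gOfRecord₁₃ F N θ.toStage13Params p) p.K
    (WtOfRecord₁₃H F N θ p s) s.init S k
    (fun j => measurable_WtOfRecord₁₃H_ζ θ p s j _ (hζm j _)) (fun j ω => hWlaws.zeta_nonneg j _ ω) (fun j ω => ?_)
    (fun j _ ω ω' hω hω' => hloc.zeta0_twoScale j _ ω ω' hω hω')
    (fun j => measurable_WtOfRecord₁₃H_w θ p s j _ _ _ (hqm j _)) (fun j ω => TkWeights.w_nonneg hWlaws j _ _ _ ω) ŵ hŵm f hfm Cf hfb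
    (fun j hj ω' hf hsupp => hdom j ω' ⟨hj, hf, hsupp⟩)
    (fun j => (∫⁻ a, ŵ j a ∂(Measure.pi fun _ : ↥(Set.toFinite (bondsIn j ((s.init.Λ (j + 1))ᶜ ∩ s.init.Ω (j + 1)))).toFinset =>
      (volume : Measure (FluctV N)))).toNNReal)
    (fun j => le_of_eq (ENNReal.coe_toNNReal (hŵfin j)).symm) hΦm (fun ω => hΦ0 _ _) CΦ (fun ω => hΦle _ _)
  -- `ζ_j(Y) = ζ0_j(Y) ≤ 1`
  rw [WtOfRecord₁₃H_eq_tkWeightsOfRecordP, tkWeightsOfRecordP_ζ_apply]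
  exact zhAt_ζ0_le_one_of_unity θ p hZ hU s j _ ω

/-- **★★★ (TWO-SCALE EDITION of p598996 §4) THE PRINT-SHAPED FACE — COERCIVITY ONLY WHERE EVERY SCALE PRESENT IS REGULAR**: for predicates `Reg_i` of the scale-`i` gauge component with
`ζ0_i((Ω_{i+1}(init s′))ᶜ)(ω) ≠ 0 → Reg_i (ω i).1` (def-T's `RegOn` consequent shape, p.256) and `FReg` of the level-`k` gauge component with `f(U) ≠ 0 → FReg U`
(the step's own small-field certificate, e.g. `χ_k(Ω_k(init s′))`, (2.17)), coercivity of `quad_j(Λ_{j+1}(init s′))` asked ONLY at configurations with `FReg (ω k).1`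
and `Reg_i (ω i).1` for every `i ∈ [j,k)` gives the integrability of `f·(old branch)` — «V regular on Γ_i for every scale present», [III] (2.10)∕(2.23).
[cite: Balaban1988Convergent, (2.10) p.256, (2.17)–(2.18) p.257, (2.20)–(2.23) p.258, (3.23)–(3.24) p.270; Balaban1987RG1, (2.11) p.267 (shape of the row)] -/
theorem integrable_front_mul_oldBranch_of_coercive_on_joint_regular₂
    (hZ : ∀ (p : B12.RunParams) (n : ℕ) (Ω Λ : ℕ → Set (Site (F.P p.K) 0)), (θ.Zh p n Ω Λ).Laws) (hU : θ.ZhUnity F N) {k : ℕ}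
    (s : SeqOfRecord F θ.ν θ.τ9.M (gOfRecord₁₃ F N θ.toStage13Params p) p.K (k + 1)) (hloc : (θ.zhAt p s).LocalLaws₂)
    (S : ℕ → Set (Site (F.P p.K) 0))
    (hζm : ∀ j (Y : Set (Site (F.P p.K) 0)), Measurable ((θ.zhAt p s).ζ0 j Y))
    (hqm : ∀ j (Λ' : Set (Site (F.P p.K) 0)), Measurable ((θ.zhAt p s).quad j Λ'))
    (f : GaugeField (F.P p.K) k (SU N) → ℝ) (hfm : Measurable f) (Cf : ℝ) (hfb : ∀ U, |f U| ≤ Cf)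
    (FReg : GaugeField (F.P p.K) k (SU N) → Prop) (hfreg : ∀ U, f U ≠ 0 → FReg U)
    (Reg : (i : ℕ) → GaugeField (F.P p.K) i (SU N) → Prop)
    (hreg : ∀ (i : ℕ) (ω : MultiCfg (F.P p.K) (SU N) (FluctV N)), (θ.zhAt p s).ζ0 i (s.init.Ω (i + 1))ᶜ ω ≠ 0 → Reg i (ω i).1)
    (hcoer : ∀ j : ℕ, j < k → ∃ c : ℝ, 0 < c ∧ ∀ ω' : MultiCfg (F.P p.K) (SU N) (FluctV N), FReg (ω' k).1 →
      (∀ i, j ≤ i → i < k → Reg i (ω' i).1) →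
      c * ∑ b ∈ (Set.toFinite (bondsIn j ((s.init.Λ (j + 1))ᶜ ∩ s.init.Ω (j + 1)))).toFinset, ‖(ω' j).2 b‖ ^ 2 ≤
        (θ.zhAt p s).quad j (s.init.Λ (j + 1)) ω')
    {Φ : SFluct (F.P p.K) (FluctV N) → MSField (F.P p.K) (SU N) → ℝ}
    (hΦm : Measurable fun ω : MultiCfg (F.P p.K) (SU N) (FluctV N) => Φ (S, fun j => (ω j).2) (fun j => (ω j).1))
    (hΦ0 : ∀ a U, 0 ≤ Φ a U) (CΦ : ℝ) (hΦle : ∀ a U, Φ a U ≤ CΦ) :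
    Integrable (fun U₀ : GaugeField (F.P p.K) k (SU N) => f U₀ *
      tkBranchOfRecord F N (FluctV N) θ.ν θ.τ9.M _ p.K (WtOfRecord₁₃H F N θ p s) s.init S k
        (fun ω => Φ (S, fun j => (ω j).2) (fun j => (ω j).1)) (baseCfg (V := FluctV N) k U₀)) (fieldMeasure (F.P p.K) k (SU N)) :=
  integrable_front_mul_oldBranch_of_coercive_on_joint_support₂ θ p hZ hU s hloc S hζm hqm f hfm Cf hfb (fun j hj => by
    obtain ⟨c, hc, h⟩ := hcoer j hj
    refine ⟨c, hc, fun ω' hf hsupp => h ω' (hfreg _ hf) fun i hji hik => ?_⟩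
    obtain ⟨cf, hcf1, -, hcfζ⟩ := hsupp i hji hik
    have hR := hreg i _ hcfζ
    rw [Function.update_self, hcf1] at hR
    exact hR) hΦm hΦ0 CΦ hΦle

end S3

end Summit.QuantumFields.YangMills.Theorems.BalabanUVNodesN11TwoScaleLocalityJointSupport

end
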